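import Summits.Ventures.HodgeRepro2.T6A2SegreRing

/-!
# T6A2SegreTransition — the Segre chart maps and their transitions

Cell pub-hodge-repro2, Tier 6 (README §10), seat t6-p2 (A2 owner; gen 14, custodial). Towards a kernel
discharge of the A2 display `Hyp.Hartshorne1977_productProjective`. With `σ × τ ≃ υ` (`(a, b) ↦ z_{ab}`),
the Segre map `(x, y) ↦ (x_a y_b)_{ab}` is, on the product chart `D₊(Xᵢ) × D₊(Yⱼ) = Spec (Aᵢ ⊗ Bⱼ)`
(`Aᵢ = (k[X]_{Xᵢ})₀`, `Bⱼ = (k[Y]_{Yⱼ})₀`), the ring map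
`segreAway : (k[Z]_{Z_{ij}})₀ → Aᵢ ⊗ Bⱼ`, `Z_{ab} / Z_{ij} ↦ (Xₐ / Xᵢ) ⊗ (Y_b / Yⱼ)` — SURJECTIVE (the
closed-immersion input on each chart). The overlap of the product charts `(i, j)` and `(a, b)` is the
basic open `D(t)`, `t = (Xₐ / Xᵢ) ⊗ (Y_b / Yⱼ)`, of `Spec (Aᵢ ⊗ Bⱼ)`; `transChart` is the chart transition
`Aₐ ⊗ B_b → (Aᵢ ⊗ Bⱼ)[1 / t]`, and `segreAway_compat` says the two Segre chart maps agree on the overlap: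
`transChart ∘ segreAway_{ab} = transAway (segreAway_{ij})` on `(k[Z]_{Z_{ab}})₀`. Mathlib only; no
display; no `sorry`; standard axioms. §8(d): uses an L-value-free non-vanishing device: NO.
Filed in Tier-6 WAVE 1 (2026-08-26) as p439601 (definition lane, ACCEPTED 10:57Z, commit a3292098f353); this v2 differs from the filed bytes in this module docstring only (the staged-record wording dropped).
-/

namespace Summit.Ventures.HodgeRepro2.T6.A2Segre

open MvPolynomial HomogeneousLocalization TensorProduct Summit.Ventures.HodgeRepro2.T6.A2Surface

attribute [local instance] MvPolynomial.gradedAlgebra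

universe u

variable (k : Type u) [CommRing k] {σ τ υ : Type u} (e : σ × τ ≃ υ)

section SegreChart

variable (i : σ) (j : τ)

/-- the Segre chart map on the polynomial description of the chart `D₊(Z_{ij})`:
`Z_c / Z_{ij} ↦ (X_{c₁} / Xᵢ) ⊗ (Y_{c₂} / Yⱼ)` -/
noncomputable def segreChart :
    MvPolynomial {c // c ≠ e (i, j)} k →ₐ[k]
      Away (homogeneousSubmodule σ k) (X i) ⊗[k] Away (homogeneousSubmodule τ k) (X j) :=
  aeval fun c => chartCoord k i (e.symm c).1 ⊗ₜ[k] chartCoord k j (e.symm c).2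

/-- `segreChart` on the variable `Z_c / Z_{ij}` -/
theorem segreChart_X (c : {c // c ≠ e (i, j)}) :
    segreChart k e i j (X c) = chartCoord k i (e.symm c).1 ⊗ₜ[k] chartCoord k j (e.symm c).2 := by
  simp [segreChart]

variable [DecidableEq υ]

/-- the Segre chart map on the chart ring `(k[Z]_{Z_{ij}})₀` -/
noncomputable def segreAway :
    Away (homogeneousSubmodule υ k) (X (e (i, j))) →ₐ[k]
      Away (homogeneousSubmodule σ k) (X i) ⊗[k] Away (homogeneousSubmodule τ k) (X j) :=
  (segreChart k e i j).comp (chartAlgEquiv k (e (i, j))).symm.toAlgHom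

/-- `Z_c / Z_{ij} ↦ (X_{c₁} / Xᵢ) ⊗ (Y_{c₂} / Yⱼ)`, for every `c` (for `c = z_{ij}` both sides are `1`) -/
theorem segreAway_chartCoord (c : υ) :
    segreAway k e i j (chartCoord k (e (i, j)) c) =
      chartCoord k i (e.symm c).1 ⊗ₜ[k] chartCoord k j (e.symm c).2 := by
  by_cases hc : c = e (i, j)
  · subst hc
    rw [chartCoord_self, map_one, Equiv.symm_apply_apply, chartCoord_self, chartCoord_self,
      Algebra.TensorProduct.one_def]
  · change segreChart k e i j ((chartAlgEquiv k (e (i, j))).symm (chartCoord k (e (i, j)) c)) = _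
    rw [chartAlgEquiv_symm_chartCoord k (e (i, j)) hc, segreChart_X]

/-- the chart `D₊(Xᵢ)` side is hit: `Xₐ ↦ Z_{aj} / Z_{ij}` lifts `Xₐ / Xᵢ ⊗ 1` -/
noncomputable def liftLeft : MvPolynomial σ k →ₐ[k] MvPolynomial {c // c ≠ e (i, j)} k :=
  aeval fun a => if h : e (a, j) = e (i, j) then 1 else X ⟨e (a, j), h⟩

/-- `segreChart ∘ liftLeft` is `toChart` followed by `Aᵢ → Aᵢ ⊗ Bⱼ` -/
theorem segreChart_comp_liftLeft :
    (segreChart k e i j).comp (liftLeft k e i j) =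
      (Algebra.TensorProduct.includeLeft :
        Away (homogeneousSubmodule σ k) (X i) →ₐ[k] _).comp (toChartₐ k i) := by
  apply MvPolynomial.algHom_ext
  intro a
  simp only [AlgHom.comp_apply, liftLeft, aeval_X, Algebra.TensorProduct.includeLeft_apply,
    toChartₐ_apply, toChart_X]
  split_ifs with h
  · have ha : a = i := (Prod.mk.inj (e.injective h)).1
    subst ha
    rw [map_one, chartCoord_self, Algebra.TensorProduct.one_def]
  · rw [segreChart_X, Equiv.symm_apply_apply, chartCoord_self]

/-- the chart `D₊(Yⱼ)` side is hit: `Y_b ↦ Z_{ib} / Z_{ij}` lifts `1 ⊗ Y_b / Yⱼ` -/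
noncomputable def liftRight : MvPolynomial τ k →ₐ[k] MvPolynomial {c // c ≠ e (i, j)} k :=
  aeval fun b => if h : e (i, b) = e (i, j) then 1 else X ⟨e (i, b), h⟩

/-- `segreChart ∘ liftRight` is `toChart` followed by `Bⱼ → Aᵢ ⊗ Bⱼ` -/
theorem segreChart_comp_liftRight :
    (segreChart k e i j).comp (liftRight k e i j) =
      (Algebra.TensorProduct.includeRight :
        Away (homogeneousSubmodule τ k) (X j) →ₐ[k] _).comp (toChartₐ k j) := by
  apply MvPolynomial.algHom_ext
  intro b
  simp only [AlgHom.comp_apply, liftRight, aeval_X, Algebra.TensorProduct.includeRight_apply,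
    toChartₐ_apply, toChart_X]
  split_ifs with h
  · have hb : b = j := (Prod.mk.inj (e.injective h)).2
    subst hb
    rw [map_one, chartCoord_self, Algebra.TensorProduct.one_def]
  · rw [segreChart_X, Equiv.symm_apply_apply, chartCoord_self]

/-- the Segre chart map on the polynomial description is surjective -/
theorem segreChart_surjective : Function.Surjective (segreChart k e i j) := by
  intro z
  induction z using TensorProduct.induction_on with
  | zero => exact ⟨0, map_zero _⟩
  | tmul a b =>
    obtain ⟨p, rfl⟩ := toChart_surjective k i a
    obtain ⟨q, rfl⟩ := toChart_surjective k j b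
    refine ⟨liftLeft k e i j p * liftRight k e i j q, ?_⟩
    rw [map_mul, ← AlgHom.comp_apply, segreChart_comp_liftLeft, ← AlgHom.comp_apply,
      segreChart_comp_liftRight]
    simp only [AlgHom.comp_apply, Algebra.TensorProduct.includeLeft_apply,
      Algebra.TensorProduct.includeRight_apply, toChartₐ_apply, Algebra.TensorProduct.tmul_mul_tmul,
      one_mul, mul_one]
  | add x y hx hy =>
    obtain ⟨p, rfl⟩ := hx
    obtain ⟨q, rfl⟩ := hy
    exact ⟨p + q, map_add _ _ _⟩

/-- the Segre chart map is surjective: the closed-immersion input on every product chart -/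
theorem segreAway_surjective : Function.Surjective (segreAway k e i j) :=
  (segreChart_surjective k e i j).comp (chartAlgEquiv k (e (i, j))).symm.surjective

end SegreChart

section Transition

variable (i a : σ) (j b : τ)

/-- the overlap element: `t = (Xₐ / Xᵢ) ⊗ (Y_b / Yⱼ)`, so that the product charts `(i, j)` and `(a, b)`
meet in `D(t) ⊂ Spec (Aᵢ ⊗ Bⱼ)` -/
noncomputable def overlapElem :
    Away (homogeneousSubmodule σ k) (X i) ⊗[k] Away (homogeneousSubmodule τ k) (X j) :=
  chartCoord k i a ⊗ₜ[k] chartCoord k j b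

/-- `t = (Xₐ / Xᵢ ⊗ 1) · (1 ⊗ Y_b / Yⱼ)` -/
theorem overlapElem_eq_mul :
    overlapElem k i a j b =
      (chartCoord k i a ⊗ₜ[k] (1 : Away (homogeneousSubmodule τ k) (X j))) *
        ((1 : Away (homogeneousSubmodule σ k) (X i)) ⊗ₜ[k] chartCoord k j b) := by
  rw [overlapElem, Algebra.TensorProduct.tmul_mul_tmul, mul_one, one_mul]

/-- the coordinate ring of the overlap `D(t)` -/
abbrev OverlapRing : Type u := Localization.Away (overlapElem k i a j b)

/-- the `k`-algebra map `Aᵢ → (Aᵢ ⊗ Bⱼ)[1 / t]` -/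
noncomputable def leftToOverlap :
    Away (homogeneousSubmodule σ k) (X i) →ₐ[k] OverlapRing k i a j b :=
  (IsScalarTower.toAlgHom k
    (Away (homogeneousSubmodule σ k) (X i) ⊗[k] Away (homogeneousSubmodule τ k) (X j))
    (OverlapRing k i a j b)).comp Algebra.TensorProduct.includeLeft

/-- `leftToOverlap x = x ⊗ 1` in the overlap ring -/
theorem leftToOverlap_apply (z : Away (homogeneousSubmodule σ k) (X i)) :
    leftToOverlap k i a j b z =
      algebraMap _ (OverlapRing k i a j b) (z ⊗ₜ[k] (1 : Away (homogeneousSubmodule τ k) (X j))) :=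
  rfl

/-- the `k`-algebra map `Bⱼ → (Aᵢ ⊗ Bⱼ)[1 / t]` -/
noncomputable def rightToOverlap :
    Away (homogeneousSubmodule τ k) (X j) →ₐ[k] OverlapRing k i a j b :=
  (IsScalarTower.toAlgHom k
    (Away (homogeneousSubmodule σ k) (X i) ⊗[k] Away (homogeneousSubmodule τ k) (X j))
    (OverlapRing k i a j b)).comp Algebra.TensorProduct.includeRight

/-- `rightToOverlap y = 1 ⊗ y` in the overlap ring -/
theorem rightToOverlap_apply (z : Away (homogeneousSubmodule τ k) (X j)) :
    rightToOverlap k i a j b z =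
      algebraMap _ (OverlapRing k i a j b) ((1 : Away (homogeneousSubmodule σ k) (X i)) ⊗ₜ[k] z) :=
  rfl

/-- `t` is a unit in `(Aᵢ ⊗ Bⱼ)[1 / t]` -/
theorem isUnit_overlapElem :
    IsUnit (algebraMap _ (OverlapRing k i a j b) (overlapElem k i a j b)) :=
  IsLocalization.Away.algebraMap_isUnit _

/-- `t = (Xₐ / Xᵢ) · (Y_b / Yⱼ)` in the overlap ring -/
theorem leftToOverlap_mul_rightToOverlap :
    leftToOverlap k i a j b (chartCoord k i a) * rightToOverlap k i a j b (chartCoord k j b) =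
      algebraMap _ (OverlapRing k i a j b) (overlapElem k i a j b) := by
  rw [leftToOverlap_apply, rightToOverlap_apply, ← map_mul]
  congr 1
  exact (overlapElem_eq_mul k i a j b).symm

/-- `Xₐ / Xᵢ` is a unit in the overlap ring -/
theorem isUnit_leftToOverlap : IsUnit (leftToOverlap k i a j b (chartCoord k i a)) :=
  isUnit_of_mul_isUnit_left
    ((leftToOverlap_mul_rightToOverlap k i a j b).symm ▸ isUnit_overlapElem k i a j b)

/-- `Y_b / Yⱼ` is a unit in the overlap ring -/
theorem isUnit_rightToOverlap : IsUnit (rightToOverlap k i a j b (chartCoord k j b)) :=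
  isUnit_of_mul_isUnit_right
    ((leftToOverlap_mul_rightToOverlap k i a j b).symm ▸ isUnit_overlapElem k i a j b)

/-- the chart transition `Aₐ ⊗ B_b → (Aᵢ ⊗ Bⱼ)[1 / t]` -/
noncomputable def transChart :
    Away (homogeneousSubmodule σ k) (X a) ⊗[k] Away (homogeneousSubmodule τ k) (X b) →ₐ[k]
      OverlapRing k i a j b :=
  Algebra.TensorProduct.productMap
    (transAwayₐ k i a (leftToOverlap k i a j b) (isUnit_leftToOverlap k i a j b))
    (transAwayₐ k j b (rightToOverlap k i a j b) (isUnit_rightToOverlap k i a j b))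

/-- the chart transition on a pure tensor -/
theorem transChart_tmul (x : Away (homogeneousSubmodule σ k) (X a))
    (y : Away (homogeneousSubmodule τ k) (X b)) :
    transChart k i a j b (x ⊗ₜ[k] y) =
      transAway k i a (leftToOverlap k i a j b).toRingHom (isUnit_leftToOverlap k i a j b) x *
        transAway k j b (rightToOverlap k i a j b).toRingHom (isUnit_rightToOverlap k i a j b) y := by
  rw [transChart, Algebra.TensorProduct.productMap_apply_tmul]
  rfl

variable [DecidableEq υ]

/-- the Segre chart map sends `Z_{ab} / Z_{ij}` to the overlap element `t` -/
theorem segreAway_chartCoord_overlap :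
    segreAway k e i j (chartCoord k (e (i, j)) (e (a, b))) = overlapElem k i a j b := by
  rw [segreAway_chartCoord, Equiv.symm_apply_apply, overlapElem]

/-- the Segre chart map of `(i, j)` followed by the restriction to the overlap -/
noncomputable def segreToOverlap :
    Away (homogeneousSubmodule υ k) (X (e (i, j))) →ₐ[k] OverlapRing k i a j b :=
  (IsScalarTower.toAlgHom k _ _).comp (segreAway k e i j)

/-- `segreToOverlap` is `segreAway` followed by the localisation map -/
theorem segreToOverlap_apply (z : Away (homogeneousSubmodule υ k) (X (e (i, j)))) :
    segreToOverlap k e i a j b z = algebraMap _ (OverlapRing k i a j b) (segreAway k e i j z) := rfl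

/-- `Z_{ab} / Z_{ij}` becomes a unit in the overlap ring -/
theorem isUnit_segreToOverlap :
    IsUnit (segreToOverlap k e i a j b (chartCoord k (e (i, j)) (e (a, b)))) := by
  rw [segreToOverlap_apply, segreAway_chartCoord_overlap]
  exact isUnit_overlapElem k i a j b

/-- **THE SEGRE CHART MAPS AGREE ON OVERLAPS**: on `(k[Z]_{Z_{ab}})₀`, the Segre chart map of `(a, b)`
followed by the chart transition equals the chart transition of the Segre chart map of `(i, j)`. -/
theorem segreAway_compat :
    (transChart k i a j b).toRingHom.comp (segreAway k e a b).toRingHom =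
      transAway k (e (i, j)) (e (a, b)) (segreToOverlap k e i a j b).toRingHom
        (isUnit_segreToOverlap k e i a j b) := by
  apply ringHom_ext_away k (e (a, b))
  · intro r
    rw [← algebraMap_away_X, RingHom.comp_apply, AlgHom.toRingHom_eq_coe, RingHom.coe_coe,
      AlgHom.toRingHom_eq_coe, RingHom.coe_coe, AlgHom.commutes, AlgHom.commutes,
      transAway_algebraMap, AlgHom.toRingHom_eq_coe, RingHom.coe_coe, AlgHom.commutes]
  · intro c
    have hL := transAway_chartCoord_mul k i a (e.symm c).1 (leftToOverlap k i a j b).toRingHom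
      (isUnit_leftToOverlap k i a j b)
    have hR := transAway_chartCoord_mul k j b (e.symm c).2 (rightToOverlap k i a j b).toRingHom
      (isUnit_rightToOverlap k i a j b)
    have hZ := transAway_chartCoord_mul k (e (i, j)) (e (a, b)) c
      (segreToOverlap k e i a j b).toRingHom (isUnit_segreToOverlap k e i a j b)
    have hT := transChart_tmul k i a j b (chartCoord k a (e.symm c).1) (chartCoord k b (e.symm c).2)
    have hU := leftToOverlap_mul_rightToOverlap k i a j b
    simp only [AlgHom.toRingHom_eq_coe, RingHom.coe_coe] at hL hR hZ hT ⊢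
    apply (isUnit_segreToOverlap k e i a j b).mul_left_injective
    simp only [RingHom.comp_apply, RingHom.coe_coe]
    rw [hZ, segreAway_chartCoord, hT, segreToOverlap_apply, segreToOverlap_apply,
      segreAway_chartCoord_overlap, ← hU, mul_mul_mul_comm, hL, hR, leftToOverlap_apply,
      rightToOverlap_apply, ← map_mul, Algebra.TensorProduct.tmul_mul_tmul, mul_one, one_mul,
      segreAway_chartCoord]

end Transition

end Summit.Ventures.HodgeRepro2.T6.A2Segre
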